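import Summits.QuantumFields.YangMills.Theorems.BalabanUVNodesN08HaarCompatibilityGuardHybridNearBlocks

/-!
# BalabanUVNodes ∕ N08 — FRESHNESS RELATIVE TO AN ARBITRARY BLOCK SET `𝔅 ⊇ Blk(S)`: under `(ρ·dU)∘(Ū^S)⁻¹` with `ρ` reading only the bonds issuing from the blocks of `𝔅`, every
# coarse bond with an end block OUTSIDE `𝔅` is fresh Haar; the transported density is a function of the bonds with BOTH end blocks in `𝔅` — the form the SECOND and later
# steps of the polymer bookkeeping consume (the input bump of a polymer reads more blocks than its guarded bonds)

WIDTH SEAT `pub-ymgap-dag-n08-w3` g7, item-3 lineage PART 37B (successor of part 37 `…GuardHybridNearBlocks`, whose canonical far set `Blk(S)` it relaxes to any finset of coarse sites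
`𝔅 ⊇ Blk(S)`), 2026-08-28.  Track A, DAG node N08 = [Balaban1985UV3] Thm 1 p. 257 (compact) + Thm 2 p. 272; key item K1⁷ `StabilityBAtRecordR13SepCoPH` (stmt-QuantumFields-20542),
`--supports … --as helper`.  COUNT-NEUTRAL.

THE POINT (located; road (ii), n08-w1 g6 `N08-NO-STACKING-MECHANISM.md` §5 (G3); count-neutral).  After one step the density excess is `Σ_S B_S` with `B_S` a function of the coarse
bonds near `S` (parts 35∕37); at the NEXT step the input density of a polymer `S′` is `B_S·1_{G_{S′}}`, which reads the blocks `𝔅 = Blk(S′) ∪ (blocks of the bonds B_S reads)` — MORE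
than `Blk(S′)`.  Part 37's canonical far set is tied to `Blk(S)`; this file records that NOTHING in parts 35∕37 used more than `Blk(S) ⊆ 𝔅`: with the far set
`Far_𝔅 = {c′ | c′.src ∉ 𝔅 ∨ c′.tgt ∉ 𝔅}` and the same first∕last-bond selection, the part-35 hypotheses hold for every `𝔅 ⊇ Blk(S)` (§1), so (§2) for every integrable `ρ` reading
only the bonds issuing from `𝔅`: **`∫ ρ·g(Ū^S)·f₂(Ū^S) dU = (∫ ρ·g(Ū^S) dU)·(∫ f₂ dV)`** for `g` reading only the bonds with both end blocks in `𝔅` and `f₂` the others, and the far-average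
identity — the transported density is a function of the bonds with both end blocks in `𝔅`.  (Polymer growth per step: `S′ ↦ 𝔅(S′) =` its end blocks ∪ the support blocks of its input.)

* §1 `blockSet_far_spec` (part-35 hypothesis `hτS` for `Far_𝔅`, `Blk(S) ⊆ 𝔅`), `mem_blockSet_of_subset` (near ⟺ both end blocks in `𝔅` is part 37's `not_canonicalFar_iff`).
* §2 ★★★ `integral_mul_hybrid_blockSetFar_eq`, ★★ `integral_mul_comp_hybrid_eq_blockSetFarAvg`.
* §3 the same at the [B10] slot's averaging `avOfPrint N S₀ j` on `SU(N)`, every `N`, standing range.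

HONEST FRAMING.  [folklore] bookkeeping over parts 35∕37 BY IMPORT; nothing of Bałaban's asserted; no density bound (part 36), NO cluster expansion ∕ (G3), NO k-uniform `hmass`; E6′ NOT
decided; N08 NOT discharged; counts unmoved (typed 28∕28 · discharged 5∕27); one finite 𝕋⁴ programme at fixed ε — R4 closes the CONDITIONAL rung `BalabanLadder.UV` only; the Yang–Mills
mass gap (Clay) is NOT proved by any of this; nothing continuum ∕ ℝ⁴ ∕ OS.  0 `sorry`, 0 `def`, 0 `instance`, standard axioms.
-/

noncomputable section

open MeasureTheory
open scoped ENNReal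

namespace Summit.QuantumFields.YangMills.BalabanUVNodes.N08HaarCompatibilityGuardHybridNearBlockSet

open Literature.MathematicalPhysics.QuantumFieldTheory.Balaban1983to89
open Literature.MathematicalPhysics.QuantumFieldTheory.Balaban1983to89.AveragingRT (axialAvg measurable_axialAvg line lineSite)
open Literature.MathematicalPhysics.QuantumFieldTheory.Balaban1983to89.BlockAveraging (Small avgFun measurable_avgFun)
open Summit.QuantumFields.Balaban3D.Proofs
open Summit.QuantumFields.YangMills.BalabanUVNodes.N08HaarCompatibilityGuardHybridFresh (integral_mul_hybrid_far_eq integral_mul_comp_hybrid_eq_farAvg)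
open Summit.QuantumFields.YangMills.BalabanUVNodes.N08HaarCompatibilityGuardHybridNearBlocks (canonical_tau_lt canonical_selected_not_mem not_canonicalFar_iff localOff_of_blockLocal)

/-! ## §1 The far set of a block set `𝔅 ⊇ Blk(S)` -/

section Geometry

variable {P : Params} {j : ℕ}

/-- ★ **THE PART-35 HYPOTHESIS FOR THE FAR SET OF ANY BLOCK SET `𝔅 ⊇ Blk(S)`**: the selected bond of a bond with an end block outside `𝔅` issues from a block outside `𝔅`, hence from
neither end block of any `c ∈ S`. [folklore] -/
theorem blockSet_far_spec (hj : j + 1 ≤ P.m + P.K) (S : Finset (PBond P (j + 1))) (𝔅 : Finset (Site P (j + 1)))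
    (hS : ∀ c ∈ S, c.src ∈ 𝔅 ∧ c.tgt ∈ 𝔅) :
    ∀ c', (c'.src ∉ 𝔅 ∨ c'.tgt ∉ 𝔅) → ∀ c ∈ S,
      blockOf (lineSite c' (if c'.src ∉ 𝔅 then 0 else P.L - 1)) ≠ c.src ∧ blockOf (lineSite c' (if c'.src ∉ 𝔅 then 0 else P.L - 1)) ≠ c.tgt := by
  intro c' hfar c hc
  have h := canonical_selected_not_mem hj 𝔅 c' hfar
  exact ⟨fun heq => h (heq ▸ (hS c hc).1), fun heq => h (heq ▸ (hS c hc).2)⟩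

/-- `Blk(S) ⊆ 𝔅` in the shape §1 consumes, from the image description. [folklore] -/
theorem mem_blockSet_of_subset (S : Finset (PBond P (j + 1))) (𝔅 : Finset (Site P (j + 1))) (h𝔅 : S.image PBond.src ∪ S.image PBond.tgt ⊆ 𝔅) :
    ∀ c ∈ S, c.src ∈ 𝔅 ∧ c.tgt ∈ 𝔅 :=
  fun _ hc => ⟨h𝔅 (Finset.mem_union_left _ (Finset.mem_image_of_mem _ hc)), h𝔅 (Finset.mem_union_right _ (Finset.mem_image_of_mem _ hc))⟩

end Geometry

/-! ## §2 Freshness relative to `𝔅` -/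

section BlockSet

variable {P : Params} {j : ℕ} {G : Type} [GaugeGroup G] (ℰ : LoopAverage G) [DecidableEq (PBond P (j + 1))] [MeasurableSpace G] [RegularGaugeGroup G] [HaarData G]

/-- ★★★ **ALL COARSE BONDS WITH AN END BLOCK OUTSIDE `𝔅` ARE FRESH UNDER `Ū^S`, `Blk(S) ⊆ 𝔅`**: for every integrable density `ρ` reading only the bonds issuing from the blocks of `𝔅`,
every bounded measurable `g` reading only the coarse bonds with both end blocks in `𝔅` and `f₂` reading only the others:
**`∫ ρ·g(Ū^S U)·f₂(Ū^S U) dU = (∫ ρ·g(Ū^S U) dU)·(∫ f₂ dV)`** (part 35 at the far set of `𝔅`). [cite: Balaban1985UV3, (10) p.258 + (48)–(49) p.268 (bookkeeping); Balaban1985Averaging, (15) p.19; Balaban1987RG1, (0.4) p.253] -/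
theorem integral_mul_hybrid_blockSetFar_eq (hj : j + 1 ≤ P.m + P.K) (hE : ∀ n, Measurable fun W : Fin (n + 1) → G => ℰ.E W) (S : Finset (PBond P (j + 1)))
    (𝔅 : Finset (Site P (j + 1))) (hS : ∀ c ∈ S, c.src ∈ 𝔅 ∧ c.tgt ∈ 𝔅)
    (ρ : Density P j G) (hρ : Integrable ρ (fieldMeasure P j G))
    (hloc : ∀ W W' : GaugeField P j G, (∀ b : PBond P j, blockOf b.src ∈ 𝔅 → W b = W' b) → ρ W = ρ W')
    (g f₂ : GaugeField P (j + 1) G → ℝ) (hg : Measurable g) (hf₂ : Measurable f₂) (Cg C₂ : ℝ) (hCg : ∀ V, |g V| ≤ Cg) (hC₂ : ∀ V, |f₂ V| ≤ C₂)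
    (hlocg : ∀ V V' : GaugeField P (j + 1) G, (∀ c, c.src ∈ 𝔅 ∧ c.tgt ∈ 𝔅 → V c = V' c) → g V = g V')
    (hloc₂ : ∀ V V' : GaugeField P (j + 1) G, (∀ c, (c.src ∉ 𝔅 ∨ c.tgt ∉ 𝔅) → V c = V' c) → f₂ V = f₂ V') :
    ∫ U, ρ U * (g (fun c => if c ∈ S then avgFun ℰ U c else axialAvg U c) * f₂ (fun c => if c ∈ S then avgFun ℰ U c else axialAvg U c))
        ∂(fieldMeasure P j G) =
      (∫ U, ρ U * g (fun c => if c ∈ S then avgFun ℰ U c else axialAvg U c) ∂(fieldMeasure P j G)) * ∫ V, f₂ V ∂(fieldMeasure P (j + 1) G) := by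
  haveI : DecidablePred fun b : PBond P j => ∃ c' : PBond P (j + 1), (c'.src ∉ 𝔅 ∨ c'.tgt ∉ 𝔅) ∧ line c' (if c'.src ∉ 𝔅 then 0 else P.L - 1) = b :=
    Classical.decPred _
  exact integral_mul_hybrid_far_eq ℰ hj hE S (fun c' : PBond P (j + 1) => c'.src ∉ 𝔅 ∨ c'.tgt ∉ 𝔅) (fun c' : PBond P (j + 1) => if c'.src ∉ 𝔅 then 0 else P.L - 1)
    (fun c' _ => canonical_tau_lt _ c') (blockSet_far_spec hj S 𝔅 hS) ρ hρ (localOff_of_blockLocal hj _ ρ hloc) g f₂ hg hf₂ Cg C₂ hCg hC₂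
    (fun V V' hVV' => hlocg V V' fun c hc => hVV' c ((not_canonicalFar_iff _ c).2 hc)) hloc₂

/-- ★★ **THE FAR-AVERAGE IDENTITY RELATIVE TO `𝔅`**: `∫ ρ·f(Ū^S U) dU = ∫ ρ·(A f)(Ū^S U) dU`, `A f` the average of `f` over the coarse variables of the bonds with an end block outside `𝔅`
— **the transported density is a function of the coarse bonds with both end blocks in `𝔅`**. [cite: Balaban1985UV3, (10) p.258 + (48)–(49) p.268 (bookkeeping); Balaban1985Averaging, (15) p.19; Balaban1987RG1, (0.4) p.253] -/
theorem integral_mul_comp_hybrid_eq_blockSetFarAvg (hj : j + 1 ≤ P.m + P.K) (hE : ∀ n, Measurable fun W : Fin (n + 1) → G => ℰ.E W) (S : Finset (PBond P (j + 1)))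
    (𝔅 : Finset (Site P (j + 1))) (hS : ∀ c ∈ S, c.src ∈ 𝔅 ∧ c.tgt ∈ 𝔅)
    (ρ : Density P j G) (hρ : Integrable ρ (fieldMeasure P j G))
    (hloc : ∀ W W' : GaugeField P j G, (∀ b : PBond P j, blockOf b.src ∈ 𝔅 → W b = W' b) → ρ W = ρ W')
    (f : GaugeField P (j + 1) G → ℝ) (hf : Measurable f) (C : ℝ) (hC : ∀ V, |f V| ≤ C) :
    ∫ U, ρ U * f (fun c => if c ∈ S then avgFun ℰ U c else axialAvg U c) ∂(fieldMeasure P j G) =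
      ∫ U, ρ U * (∫ v, f ((FibreSplit.splitEquiv (fun c' : PBond P (j + 1) => c'.src ∉ 𝔅 ∨ c'.tgt ∉ 𝔅) (P := P) (G := G)).symm
          ((FibreSplit.splitEquiv (fun c' : PBond P (j + 1) => c'.src ∉ 𝔅 ∨ c'.tgt ∉ 𝔅) (P := P) (G := G)
            (fun c => if c ∈ S then avgFun ℰ U c else axialAvg U c)).1, v))
        ∂(Measure.pi fun _ : {c : PBond P (j + 1) // ¬¬ (c.src ∉ 𝔅 ∨ c.tgt ∉ 𝔅)} => (HaarData.haar : Measure G))) ∂(fieldMeasure P j G) := by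
  haveI : DecidablePred fun b : PBond P j => ∃ c' : PBond P (j + 1), (c'.src ∉ 𝔅 ∨ c'.tgt ∉ 𝔅) ∧ line c' (if c'.src ∉ 𝔅 then 0 else P.L - 1) = b :=
    Classical.decPred _
  exact integral_mul_comp_hybrid_eq_farAvg ℰ hj hE S (fun c' : PBond P (j + 1) => c'.src ∉ 𝔅 ∨ c'.tgt ∉ 𝔅) (fun c' : PBond P (j + 1) => if c'.src ∉ 𝔅 then 0 else P.L - 1)
    (fun c' _ => canonical_tau_lt _ c') (blockSet_far_spec hj S 𝔅 hS) ρ hρ (localOff_of_blockLocal hj _ ρ hloc) f hf C hC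

end BlockSet

/-! ## §3 At the [B10] slot's averaging `avOfPrint N S₀ j` on `SU(N)` -/

section Slot

open Literature.MathematicalPhysics.QuantumFieldTheory.Balaban1985CMP102.Setting (Scales)
open Literature.MathematicalPhysics.QuantumFieldTheory.Balaban1983to89.ExpMeanLog (expMeanLogSU measurable_expMeanLogSU_E)
open Literature.MathematicalPhysics.QuantumFieldTheory.Balaban1983to89.Node00 (SU)

variable (N : ℕ) [NeZero N] {L : ℕ}

/-- ★★★ **AT THE SLOT**: under the hybrid of print's averaging on `SU(N)` (every `N`, standing range), for `Blk(S) ⊆ 𝔅` and every integrable density reading only the blocks of `𝔅`,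
the coarse variables of all bonds with an end block outside `𝔅` are product Haar, independent of the rest. [cite: Balaban1985UV3, (2) p.256 + (10) p.258; Balaban1985Averaging, (15) p.19; Balaban1987RG1, (0.4) p.253 (bookkeeping)] -/
theorem integral_mul_hybrid_blockSetFar_eq_avOfPrint (S₀ : Scales L) {j : ℕ} (hj : j + 1 ≤ S₀.P.m + S₀.P.K) [DecidableEq (PBond S₀.P (j + 1))]
    (S : Finset (PBond S₀.P (j + 1))) (𝔅 : Finset (Site S₀.P (j + 1))) (hS : ∀ c ∈ S, c.src ∈ 𝔅 ∧ c.tgt ∈ 𝔅)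
    (ρ : Density S₀.P j (SU N)) (hρ : Integrable ρ (fieldMeasure S₀.P j (SU N)))
    (hloc : ∀ W W' : GaugeField S₀.P j (SU N), (∀ b : PBond S₀.P j, blockOf b.src ∈ 𝔅 → W b = W' b) → ρ W = ρ W')
    (g f₂ : GaugeField S₀.P (j + 1) (SU N) → ℝ) (hg : Measurable g) (hf₂ : Measurable f₂) (Cg C₂ : ℝ) (hCg : ∀ V, |g V| ≤ Cg) (hC₂ : ∀ V, |f₂ V| ≤ C₂)
    (hlocg : ∀ V V' : GaugeField S₀.P (j + 1) (SU N), (∀ c, c.src ∈ 𝔅 ∧ c.tgt ∈ 𝔅 → V c = V' c) → g V = g V')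
    (hloc₂ : ∀ V V' : GaugeField S₀.P (j + 1) (SU N), (∀ c, (c.src ∉ 𝔅 ∨ c.tgt ∉ 𝔅) → V c = V' c) → f₂ V = f₂ V') :
    ∫ U, ρ U * (g (fun c => if c ∈ S then avgFun (expMeanLogSU : LoopAverage (SU N)) U c else axialAvg U c) *
        f₂ (fun c => if c ∈ S then avgFun (expMeanLogSU : LoopAverage (SU N)) U c else axialAvg U c)) ∂(fieldMeasure S₀.P j (SU N)) =
      (∫ U, ρ U * g (fun c => if c ∈ S then avgFun (expMeanLogSU : LoopAverage (SU N)) U c else axialAvg U c) ∂(fieldMeasure S₀.P j (SU N))) *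
        ∫ V, f₂ V ∂(fieldMeasure S₀.P (j + 1) (SU N)) :=
  integral_mul_hybrid_blockSetFar_eq (expMeanLogSU : LoopAverage (SU N)) hj measurable_expMeanLogSU_E S 𝔅 hS ρ hρ hloc g f₂ hg hf₂ Cg C₂ hCg hC₂ hlocg hloc₂

end Slot

end Summit.QuantumFields.YangMills.BalabanUVNodes.N08HaarCompatibilityGuardHybridNearBlockSet

end
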